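import Literature.MathematicalPhysics.QuantumFieldTheory.Balaban1983to89.B16Improved189FullBudgetIndex

/-!
# `Balaban1983to89.B16Improved189FullBudgetStep` — [Balaban1989LargeFieldII] pp. 385–387: THE INDUCTIVE STEP `j → j+1` OF
THE STRENGTHENED STATEMENT (1.80)⁺ ASSEMBLED from the four printed provenances of a component of `Z_{j+1}` — continuation
(1.83), the reset of p. 386, «the first induction step», the merger (1.85)–(1.88) — each WITH ITS TERMINAL TERM; and the
full-budget improved (1.89) from a provenance history

T. Bałaban, *Large field renormalization. II. Localization, exponentiation, and bounds for the 𝐑 operation*, Commun.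
Math. Phys. **122** (1989) 355–392, doi:10.1007/bf01238433 [Balaban1989LargeFieldII] (cell paper B16 = [V]; PDF held
`paper:balaban1989-cmp122-large-field-ii`, journal page = PDF page + 354; pp. 385–387 = PDF 31–33).

statement-level bookkeeping of a published proof with citation tags; proofs kernel-checked; nothing here is a claim
about the Yang–Mills mass gap

CITATION HEADER ∕ WHAT IS PRINTED.  p. 385 [PDF 31]: *"Assume that the statement is true for some j, and take a component
Z of Z_{j+1}. We consider two cases. In the first case no large fields were introduced in the last step, hence Z = S(Z₀)
… (1.83) … In this case we should consider also the domains Z such that Z = S(Z₀), Z₀ satisfies the conditions (i), (ii),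
and a new large field was introduced …"*; p. 386 [PDF 32]: *"In the second case Z is obtained from some number of
components of Z_j, and some number of new large field regions, joined together into the one component of Z_{j+1} …
(1.85) … We have proved (1.80), if this number is equal to 1, because then we have either the situation covered by (1.83),
or by the first induction step."*; p. 387 [PDF 33] l. 16: *"This completes the inductive proof of the statement."*

THE LOCATED ITEM (referee ref-M READ-2 on p583371, LOCATED (ii): «in the capstone `improved189_full_ofIndex` the per-scale
step `hstep : ∀ j ≥ j₀, invariant(j) → invariant(j+1)` … [is an] INPUT — §2–§4 supply case certificates only for components
WITH provenance data, and no history-level assembly of `hstep` from them is in the file»).  `B16Lem384Induction` §4 assembles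
the UNstrengthened step from a `Transition` (data: a printed `Case` per component of `Z_{j+1}`); `B16Improved189FullBudget` §4
left the strengthened step «assembled by the consumer».  THIS FILE assembles it, theorems only: the merger WITH THE TERM over
the bookkeeping `MergeCase` data of `B16Lem384Induction` §3 (§1), then **the step of (1.80)⁺ from a PROVENANCE for every
component of `Z_{j+1}`** (§2: each component is a continuation of an old component with `K ≥ 1` carrying the same terminal
term, or a reset with the small-domain bound charged with the term, or a region born at `j+1` with `3Q ≤ a` and the terminal
bound `t ≤ Q(d′+1)`, or a merger with terms bounded on the subfamilies and «p₀ large and γ small enough» charged with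
`E_t`), and the full-budget improved (1.89) from (1.80)⁺ at a first scale and a provenance at every later scale (§3).

WHAT THIS FILE PROVES (kernel-checked, zero `sorry`, theorems only — no `def`; axioms standard; BY NAME:
`B16Improved189FullBudget.{case1T_183, resetT_p386, bornT_controls, mergeT_controls, hsingleT_old, hsingleT_new,
controlsT_mono, invariantT_all, improved189_full_of_invariantT}`, `B16Improved189FullBudgetIndex.htsub_of_abs_bound`,
`B16Lem384Induction.{OldPiece, Birth, Piece, MergeCase (fields hleaf hP hc hsub hcost1 hrhs1 hrhsZ hne hconn)}` — nothing
re-proved):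
§1 **`mergeT_controls_ofCase`** — (1.80)⁺ for the merged component over `MergeCase` data with terminal terms on the
   subfamilies (non-negative, bounded by `E_t` on connected subfamilies, single-piece bounds), located `hbudgetT : E + E_t +
   Dc ≤ q`; `hsingleT` discharged from (1.80)⁺ at scale `j` ∕ the first induction step with the term, `htsub` from
   `htsub_of_abs_bound`.
§2 **`invariantT_succ_of_provenance`** — THE STEP: (1.80)⁺ at scale `j` and a printed provenance with its terminal data for
   every component of the scale-`j+1` data give (1.80)⁺ at scale `j+1` («This completes the inductive proof»).
§3 **`improved189_full_of_provenance_history`** — the full-budget improved (1.89) `𝐓′_k(X)1 ≤ exp(−2(1+β₀)⁻¹p₀(g_k) −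
   κ₁d(X))` for a horizon-`0` component from (1.80)⁺ at a first scale (e.g. `invariantT_base_ofIndex`) and a provenance at
   every later scale — `hstep` DISCHARGED.
§4 `toy_provenance_step` — §2's provenance hypothesis inhabited by a pure-continuation step of the toy history of
   `B16Improved189FullBudget.toy_history_full` (A6).
§5 **`controlsT_birth_ofIndex_of_find`** — the birth certificate for PRINT's `K` (the least stopping index, `Nat.find`): `hKmin`
   by minimality and condition (i) at the terminal iterate by the stopping property itself — `hIK` DISCHARGED (ref-M LOCATED
   (iii)).
HONEST SCOPE.  Bookkeeping model of `Step.Budget` ∕ `B16Lem384Induction` (components, budgets, profiles, horizons, terminal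
terms abstract); the index-model suppliers of the four provenances are `B16Improved189FullBudgetIndex` §§2–4 (through
`MergeIndex.toMergeCase` for the merger); print's `hsub` and the located conditions stay named inputs inside the
provenance data; nothing of (1.79)–(1.89) asserted about Bałaban's densities; N13 NOT discharged; count-neutral; one finite
𝕋⁴ programme at fixed ε, Bałaban AS PRINTED; R4 closes the conditional finite-𝕋⁴ rung `BalabanLadder.UV` only — nothing
continuum ∕ OS ∕ mass gap ∕ Clay.  Seat `pub-ymgap-dag-n13-w2` (g0), YM-DAG node N13 [B16] Cor. 3, W-SEAT-START-LIST §1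
n13 item 2, `--supports stmt-QuantumFields-20542`.
-/

noncomputable section

namespace Literature.MathematicalPhysics.QuantumFieldTheory.Balaban1983to89.B16Improved189FullBudgetStep

open Literature.MathematicalPhysics.QuantumFieldTheory.Balaban1983to89
open Literature.MathematicalPhysics.QuantumFieldTheory.Balaban1983to89.Step
open Literature.MathematicalPhysics.QuantumFieldTheory.Balaban1983to89.Step.Budget
open Literature.MathematicalPhysics.QuantumFieldTheory.Balaban1983to89.B16Improved189FullBudget
open Literature.MathematicalPhysics.QuantumFieldTheory.Balaban1983to89.B16Improved189FullBudgetIndex (htsub_of_abs_bound)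
open Literature.MathematicalPhysics.QuantumFieldTheory.Balaban1983to89.B16Lem384Induction

/-! ## §1. The merger (1.85)–(1.88) with the term over bookkeeping `MergeCase` data -/

/-- **(1.80)⁺ FOR THE MERGED COMPONENT OVER `MergeCase` DATA** (bookkeeping twin of
`B16Improved189FullBudgetIndex.mergeT_controls_ofIndex`): a merger `M : MergeCase b D ι` of `B16Lem384Induction` §3 (pieces,
`Pf`, `cost`, `rhs`, `Conn` with the endpoint property, print's `hP`∕`hc`∕`hsub`, the merged component's `K`∕`size` with
`hrhsZ`; its own `hbudget : E + Dc ≤ q` is NOT used), (1.80)⁺ AT SCALE `j` with terminal terms `tD` (`hDT`), terminal terms `t`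
of the subfamilies (non-negative, `≤ E_t` on connected subfamilies, an old piece's at most its scale-`j` term, a new piece's
at most `Q(d′+1)` under `3Q ≤ a`), and «for p₀ large and γ small enough» charged with `E_t` (`hbudgetT : E + E_t + Dc ≤
q`): for every `t_Z ≤ t(S)` the budget (1.85) LOWERED BY `t_Z` controls the `K` steps — `mergeT_controls`. [cite: Balaban1989LargeFieldII, (1.85)–(1.88) pp.386–387] -/
theorem mergeT_controls_ofCase (b : Budget.Consts) {j : ℕ} {D : ScaleData j} {ι : Type} [DecidableEq ι]
    (M : MergeCase b D ι) (tD : D.Comp → ℝ)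
    (hDT : ∀ Z, Controls b j (D.K Z) (D.κ Z - tD Z) (D.size Z))
    (t : Finset ι → ℝ) (ht0 : ∀ T, T ⊆ M.S → 0 ≤ t T) (Et : ℝ)
    (htE : ∀ T, T ⊆ M.S → M.Conn T → t T ≤ Et)
    (ht1_old : ∀ x ∈ M.S, ∀ y : OldPiece D, M.prov x = Piece.old y → t {x} ≤ tD y.Z₀)
    (ht1_new : ∀ x ∈ M.S, ∀ y : Birth b (j + 1), M.prov x = Piece.new y →
      t {x} ≤ y.Q * (y.d' + 1) ∧ 3 * y.Q ≤ y.a)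
    (hbudgetT : M.E + Et + M.Dc ≤ M.q) (tZ : ℝ) (htZ : tZ ≤ t M.S) :
    Controls b (j + 1) M.K (M.κ' - tZ) M.size := by
  have hsingleT : ∀ x ∈ M.S, M.rhs {x} + t {x} ≤ merge M.contrib {x} (M.cost {x}) (M.Pf {x}) := by
    intro x hx
    rw [M.hrhs1 x hx]
    unfold merge MergeCase.contrib
    rw [Finset.sum_singleton, M.hcost1 x hx]
    suffices h : (M.prov x).rhs180 b + t {x} ≤ (M.prov x).base - b.cost (j + 1) (M.prov x).d1 by linarith
    rcases hpx : M.prov x with y | y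
    · have h := hsingleT_old b j (D.K y.Z₀) y.hK (D.κ y.Z₀) (tD y.Z₀) (D.size y.Z₀) (hDT y.Z₀)
      have h1 := ht1_old x hx y hpx
      show (∑ n ∈ Finset.Ioc (j + 1) (j + 1 + (D.K y.Z₀ - 1)), b.cost n (D.size y.Z₀ n)) + t {x} ≤
        D.κ y.Z₀ - b.cost (j + 1) (D.size y.Z₀ (j + 1))
      linarith
    · have h1 := ht1_new x hx y hpx
      exact hsingleT_new b (j + 1) y.K y.a y.Q (t {x}) y.d' y.size y.hd' y.hrhs y.hcost h1.1 h1.2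
  exact mergeT_controls b j M.contrib M.cost M.Pf M.rhs t M.S M.hne M.Conn M.hconn M.q M.E Et M.Dc M.hleaf hsingleT M.hP
    M.hc M.hsub (htsub_of_abs_bound t M.S M.Conn Et ht0 htE) hbudgetT M.K M.size _ tZ M.hrhsZ htZ le_rfl

/-! ## §2. The step `j → j+1` of (1.80)⁺ from a provenance for every component -/

/-- **THE INDUCTIVE STEP OF (1.80)⁺, ASSEMBLED** (p. 385 «Assume that the statement is true for some j, and take a component Z
of Z_{j+1}. We consider two cases …» — p. 387 «This completes the inductive proof of the statement», re-run with the terminal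
term): from (1.80)⁺ for every component at scale `j` (terms `tD`) and, for every component `Z` of the scale-`j+1` data with
its terminal term `t′(Z)`, ONE OF THE FOUR PRINTED PROVENANCES with its terminal data —
(a) CONTINUATION (1.83): `Z = S(Z₀)` for an old component `Z₀` with `K(Z₀) ≥ 1`; `Z`'s horizon∕profile are `Z₀`'s shifted,
    its budget is at least `κ_j(Z₀) − cost`, and its term is at most `Z₀`'s (the SAME terminal domain `S^{K−1}(S(Z₀)) = S^K(Z₀)`);
(b) RESET (p. 386): horizon `K`, profile `s`, a fresh amount `p` with `p − cost_{j+1}(s_{j+1}) ≤ κ_{j+1}(Z)` and the small-domain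
    bound charged with the term, `Σ_{n=j+1}^{j+1+K} cost_n(s_n) + t′(Z) ≤ p`;
(c) BIRTH («the first induction step» at `j+1`): birth data `x` (its `hrhs`, `hcost`) with `3Q ≤ a`, `t′(Z) ≤ Q(d′+1)`, budget
    at least the (1.82)-budget;
(d) MERGER (1.85)–(1.88): `MergeCase` data with terminal terms on the subfamilies as in `mergeT_controls_ofCase`, budget at
    least (1.85), `t′(Z) ≤ t(S)` —
(1.80)⁺ holds for every component at scale `j+1`. [cite: Balaban1989LargeFieldII, pp.385–387 (the inductive proof)] -/
theorem invariantT_succ_of_provenance (b : Budget.Consts) {j : ℕ} (D : ScaleData j) (D' : ScaleData (j + 1))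
    (tD : D.Comp → ℝ) (t' : D'.Comp → ℝ)
    (hDT : ∀ Z, Controls b j (D.K Z) (D.κ Z - tD Z) (D.size Z))
    (hprov : ∀ Z : D'.Comp,
      (∃ x : OldPiece D, D'.K Z = x.K' ∧ D'.size Z = x.size' ∧ x.κ' b ≤ D'.κ Z ∧ t' Z ≤ tD x.Z₀) ∨
      (∃ (p : ℝ) (K : ℕ) (s : ℕ → ℝ), D'.K Z = K ∧ D'.size Z = s ∧ p - b.cost (j + 1) (s (j + 1)) ≤ D'.κ Z ∧
        ∑ n ∈ Finset.Ioc j (j + 1 + K), b.cost n (s n) + t' Z ≤ p) ∨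
      (∃ x : Birth b (j + 1), D'.K Z = x.K ∧ D'.size Z = x.size ∧ x.κ' ≤ D'.κ Z ∧ t' Z ≤ x.Q * (x.d' + 1) ∧
        3 * x.Q ≤ x.a) ∨
      (∃ (ι : Type) (_ : DecidableEq ι) (M : MergeCase b D ι) (t : Finset ι → ℝ) (Et : ℝ),
        D'.K Z = M.K ∧ D'.size Z = M.size ∧ M.κ' ≤ D'.κ Z ∧ t' Z ≤ t M.S ∧
        (∀ T, T ⊆ M.S → 0 ≤ t T) ∧ (∀ T, T ⊆ M.S → M.Conn T → t T ≤ Et) ∧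
        (∀ x ∈ M.S, ∀ y : OldPiece D, M.prov x = Piece.old y → t {x} ≤ tD y.Z₀) ∧
        (∀ x ∈ M.S, ∀ y : Birth b (j + 1), M.prov x = Piece.new y → t {x} ≤ y.Q * (y.d' + 1) ∧ 3 * y.Q ≤ y.a) ∧
        M.E + Et + M.Dc ≤ M.q)) :
    ∀ Z, Controls b (j + 1) (D'.K Z) (D'.κ Z - t' Z) (D'.size Z) := by
  intro Z
  rcases hprov Z with ⟨x, hK, hs, hκ, ht⟩ | ⟨p, K, s, hK, hs, hκ, hsmall⟩ | ⟨x, hK, hs, hκ, ht, h3⟩ |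
      ⟨ι, _, M, t, Et, hK, hs, hκ, htZ, ht0, htE, ht1o, ht1n, hbud⟩
  · -- (a) continuation (1.83): the same term
    have h := case1T_183 b j (D.K x.Z₀) x.hK (D.κ x.Z₀) (tD x.Z₀) (D.size x.Z₀) (hDT x.Z₀)
    rw [hK, hs]
    exact controlsT_mono b (j + 1) _ _ h hκ ht
  · -- (b) reset p. 386, the term charged to the small-domain bound
    have h := resetT_p386 b j K p (t' Z) s hsmall
    rw [hK, hs]
    exact controlsT_mono b (j + 1) _ _ h hκ le_rfl
  · -- (c) the first induction step at j+1 with the term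
    have h := bornT_controls b (j + 1) x.K x.κ' x.a x.Q (t' Z) x.d' x.size x.hd' le_rfl x.hrhs x.hcost ht h3
    rw [hK, hs]
    exact controlsT_mono b (j + 1) _ _ h hκ le_rfl
  · -- (d) the merger with terms on the subfamilies
    have h := mergeT_controls_ofCase b M tD hDT t ht0 Et htE ht1o ht1n hbud (t' Z) htZ
    rw [hK, hs]
    exact controlsT_mono b (j + 1) _ _ h hκ le_rfl

/-! ## §3. The full-budget improved (1.89) from a provenance history -/

/-- **THE FULL-BUDGET IMPROVED (1.89) FROM A PROVENANCE HISTORY** — `B16Improved189FullBudget.improved189_full_of_history` ∕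
`B16Improved189FullBudgetIndex.improved189_full_ofIndex` with the per-scale step `hstep` DISCHARGED: bookkeeping data `D j`
with terminal terms `t j`, (1.80)⁺ at a first scale `j₀` (`hbase`; e.g. `invariantT_base_ofIndex`), a printed PROVENANCE with
its terminal data for every component of every `Z_{j+1}`, `j ≥ j₀` (`hprov`, as in §2), and a horizon-`0` component `X` of `Z_k`,
`k ≥ j₀`, with `κ₁·d(X) ≤ t_k(X)` and the factor form `𝐓′1 ≤ exp(−κ_k(X) − P)`, `P ≥ 2(1+β₀)⁻¹p₀(g_k)`: THEN `𝐓′_k(X)1 ≤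
exp(−2(1+β₀)⁻¹p₀(g_k) − κ₁d(X))`. [cite: Balaban1989LargeFieldII, (1.80) p.384, pp.385–387, (1.89) p.387] -/
theorem improved189_full_of_provenance_history (b : Budget.Consts) (D : (j : ℕ) → ScaleData j)
    (t : (j : ℕ) → (D j).Comp → ℝ) (j₀ : ℕ)
    (hbase : ∀ Z, Controls b j₀ ((D j₀).K Z) ((D j₀).κ Z - t j₀ Z) ((D j₀).size Z))
    (hprov : ∀ j, j₀ ≤ j → ∀ Z : (D (j + 1)).Comp,
      (∃ x : OldPiece (D j), (D (j + 1)).K Z = x.K' ∧ (D (j + 1)).size Z = x.size' ∧ x.κ' b ≤ (D (j + 1)).κ Z ∧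
        t (j + 1) Z ≤ t j x.Z₀) ∨
      (∃ (p : ℝ) (K : ℕ) (s : ℕ → ℝ), (D (j + 1)).K Z = K ∧ (D (j + 1)).size Z = s ∧
        p - b.cost (j + 1) (s (j + 1)) ≤ (D (j + 1)).κ Z ∧ ∑ n ∈ Finset.Ioc j (j + 1 + K), b.cost n (s n) + t (j + 1) Z ≤ p) ∨
      (∃ x : Birth b (j + 1), (D (j + 1)).K Z = x.K ∧ (D (j + 1)).size Z = x.size ∧ x.κ' ≤ (D (j + 1)).κ Z ∧
        t (j + 1) Z ≤ x.Q * (x.d' + 1) ∧ 3 * x.Q ≤ x.a) ∨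
      (∃ (ι : Type) (_ : DecidableEq ι) (M : MergeCase b (D j) ι) (tt : Finset ι → ℝ) (Et : ℝ),
        (D (j + 1)).K Z = M.K ∧ (D (j + 1)).size Z = M.size ∧ M.κ' ≤ (D (j + 1)).κ Z ∧ t (j + 1) Z ≤ tt M.S ∧
        (∀ T, T ⊆ M.S → 0 ≤ tt T) ∧ (∀ T, T ⊆ M.S → M.Conn T → tt T ≤ Et) ∧
        (∀ x ∈ M.S, ∀ y : OldPiece (D j), M.prov x = Piece.old y → tt {x} ≤ t j y.Z₀) ∧
        (∀ x ∈ M.S, ∀ y : Birth b (j + 1), M.prov x = Piece.new y → tt {x} ≤ y.Q * (y.d' + 1) ∧ 3 * y.Q ≤ y.a) ∧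
        M.E + Et + M.Dc ≤ M.q))
    {k : ℕ} (hk : j₀ ≤ k) (X : (D k).Comp) (hK : (D k).K X = 0) (κ₁ : ℝ) (dX : (D k).Comp → ℝ)
    (hd : κ₁ * dX X ≤ t k X) {V : Type*} (T1X : V → ℝ) (A₀ : ℝ) (p₀ : ℕ) (β₀ gk P : ℝ)
    (hT : ∀ v, T1X v ≤ Real.exp (-(D k).κ X - P)) (hP : 2 * (1 + β₀)⁻¹ * p0Profile A₀ p₀ gk ≤ P) :
    ∀ v, T1X v ≤ Real.exp (-(2 * (1 + β₀)⁻¹ * p0Profile A₀ p₀ gk) - κ₁ * dX X) :=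
  improved189_full_of_invariantT b (t k)
    (invariantT_all b D t j₀ hbase
      (fun j hj hDj => invariantT_succ_of_provenance b (D j) (D (j + 1)) (t j) (t (j + 1)) hDj (hprov j hj)) k hk)
    X hK κ₁ dX hd T1X A₀ p₀ β₀ gk P hT hP

/-! ## §4. Non-vacuity: a provenance step of the toy history -/

/-- **§2's provenance hypothesis is inhabited** (A6) by the pure-continuation step of the toy history of
`B16Improved189FullBudget.toy_history_full` (constants `O(1) = M = 1`, `d = 1`, `R ≡ 1`; one component born at scale `1`
with budget `5`, term `2`, horizon `1`; at scale `2` it CONTINUES — provenance (a) — to budget `4`, horizon `0`, the same term),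
and (1.80)⁺ then holds at scale `2` with the non-zero term. [cite: Balaban1989LargeFieldII, (1.82)–(1.83) p.385] -/
theorem toy_provenance_step :
    let b : Budget.Consts := ⟨1, 1, 1, fun _ => 1⟩
    let D2 : ScaleData 2 := ⟨Unit, fun _ => 1, fun _ => by omega, fun _ => 4, fun _ _ => 1, fun _ => 0⟩
    ∀ Z, Controls b 2 (D2.K Z) (D2.κ Z - (fun _ => (2 : ℝ)) Z) (D2.size Z) := by
  intro b D2
  let D1 : ScaleData 1 := ⟨Unit, fun _ => 1, fun _ => le_rfl, fun _ => 5, fun _ _ => 1, fun _ => 1⟩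
  have hcost : ∀ n (s : ℝ), b.cost n s = s := fun n s => by simp [b, Budget.Consts.cost]
  have h1 : ∀ Z : D1.Comp, Controls b 1 (D1.K Z) (D1.κ Z - (fun _ => (2 : ℝ)) Z) (D1.size Z) := by
    intro Z
    show Controls b 1 1 (5 - 2) (fun _ => 1)
    refine bornT_controls b 1 1 5 3 1 2 1 (fun _ => 1) zero_le_one ?_ ?_ ?_ ?_ ?_
    · rw [hcost]; norm_num
    · rw [show (1 : ℕ) + 1 = 2 by rfl, show Finset.Ioc 1 2 = {2} by rfl, Finset.sum_singleton, hcost]; norm_num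
    · rw [hcost]; norm_num
    · norm_num
    · norm_num
  refine invariantT_succ_of_provenance b D1 D2 (fun _ => 2) (fun _ => 2) h1 ?_
  intro Z
  refine Or.inl ⟨⟨(), le_rfl⟩, rfl, rfl, ?_, le_rfl⟩
  show (5 : ℝ) - b.cost (1 + 1) 1 ≤ 4
  rw [hcost]; norm_num

/-! ## §5. Print's `K` (the least stopping index): condition (i) at the terminal iterate DISCHARGED at birth -/

/-- **`controlsT_birth_ofIndex` FOR PRINT'S `K`** (p. 384 «the number K is the smallest positive integer having the property that
the domain S^K(Z) … satisfies the conditions (i), (ii)»; referee ref-M READ-2 LOCATED (iii): «`hIK` … is an INPUT at birth»):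
when a stopping index exists inside the flow (`hex`, `hmK`), take `K := Nat.find hex`; then `hKmin` holds by minimality
(`Nat.find_min'`) and condition (i) for the terminal iterate `S^K(Z)` IS the stopping property's own clause
(`B16StoppingRule.find_stopAt_spec`), so (1.80)⁺ at the creation scale holds with `hIK` DISCHARGED — the remaining inputs are
the flow, `κ₁ ≥ 0`, the located clause and `3Q ≤ a`. [cite: Balaban1989LargeFieldII, p.384 (definition of K), (1.82) p.385] -/
theorem controlsT_birth_ofIndex_of_find (b : Budget.Consts) {d L p Kf : ℕ} (hL : 4 ≤ L) {g : ℕ → ℝ} {γ β' β₀ : ℝ}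
    (hI : Step.InInterval γ Kf g) (hγ1 : γ ≤ 1) (R : ℕ → ℕ)
    (hR : ∀ n, n ≤ Kf → B14.IsRj L p (g n) (R n)) (hbR : ∀ n, n ≤ Kf → b.R n = (R n : ℝ))
    (h29a : ∀ m n, m < n → n ≤ Kf → (R n : ℝ) ≤ L * R m) (h27 : B14.FlowIneq27 g β' β₀ p Kf)
    (hΘ : ∀ m n, m < n → n ≤ Kf → (1 + (g n) ^ 2 * β' * ((n : ℝ) - m)) ^ β₀ ≤ (L : ℝ) ^ (max (n - m) 2 / 2))
    (hC : 0 ≤ b.C) (hM : 0 ≤ b.M) {Z : Finset (B13ScaleTransfer.Pt d)} (hZ : Z.Nonempty)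
    (hZc : B13ScaleTransfer.FaceConnected Z) (m : ℕ) (Nsz : ℕ) (hNsz : 64 ≤ Nsz) (Clean : ℕ → Prop)
    (hclean : ∀ l, 1 ≤ l → l ≤ Kf - m → Clean l)
    [DecidablePred (B16StoppingRule.StopAt Nsz (R m) Clean
      (fun i => B16SProfile.Siter (B16SProfile.ratio L (fun i => Nat.log L (R (m + i)))) i Z))]
    (hex : ∃ K, B16StoppingRule.StopAt Nsz (R m) Clean
      (fun i => B16SProfile.Siter (B16SProfile.ratio L (fun i => Nat.log L (R (m + i)))) i Z) K)
    (hmK : m + Nat.find hex ≤ Kf) {κ₁ : ℝ} (hκ₁ : 0 ≤ κ₁)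
    (hclause : κ₁ * (((Nsz : ℝ) * R (m + Nat.find hex)) ^ d - 1) ≤
      10 * 126 ^ d * (b.C * b.M ^ b.d * (L : ℝ) ^ (b.d + 1) * b.R m ^ (b.d + 2)))
    (a : ℝ) (hcond3 : 3 * (10 * 126 ^ d * (b.C * b.M ^ b.d * (L : ℝ) ^ (b.d + 1) * b.R m ^ (b.d + 2))) ≤ a) :
    Controls b m (Nat.find hex) (a * (TreeLength.treeLen Z + 1) - b.cost m (TreeLength.treeLen Z)
        - κ₁ * TreeLength.treeLen (B13Factor210Literal.fineCubes (R (m + Nat.find hex))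
          (B16SProfile.Siter (B16SProfile.ratio L (fun i => Nat.log L (R (m + i)))) (Nat.find hex) Z)))
      (fun n => TreeLength.treeLen (B16SProfile.Siter (B16SProfile.ratio L (fun i => Nat.log L (R (m + i)))) (n - m) Z)) :=
  B16Improved189FullBudgetIndex.controlsT_birth_ofIndex b hL hI hγ1 R hR hbR h29a h27 hΘ hC hM hZ hZc m (Nat.find hex) hmK
    Nsz hNsz Clean hclean (fun _ hK' => Nat.find_min' hex hK') (B16StoppingRule.find_stopAt_spec hex).1.2.1 hκ₁ hclause a
    hcond3

end Literature.MathematicalPhysics.QuantumFieldTheory.Balaban1983to89.B16Improved189FullBudgetStep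

end
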